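import Summits.HodgeConjecture.CorCM.CurveTimesMultiquadraticCMPowers
import Summits.HodgeConjecture.CorCM.CurveTimesMultiquadraticCMSquare
import Summits.HodgeConjecture.CorCM.CyclotomicRankCensusOctic
import Mathlib.NumberTheory.Cyclotomic.Gal
import HarnessLib

/-!
# A CM elliptic curve times a simple abelian fourfold with complex multiplication by `ℚ(ζ₂₄) = ℚ(i, √2, √3)`:
# product span and the Hodge conjecture for `E × Y`, failure of product span on some `E^{a+1} × Y^{a+1}`

COR-CM (cell `pub-hodgecm2`, binder seat `b25` gen 35, count-neutral claim PRODSPAN-POWERS (F17): the CONCRETE instance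
of `CorCM/CurveTimesMultiquadraticCMHodge` / `…Powers`, discharging their field-theoretic hypotheses for the octic
cyclotomic field `ℚ(ζ₂₄)` with the tree's census `CorCM/CyclotomicRankCensusOctic` (seat b04)).  NEW as stated, hence
under `Summits/`.  Theorems only; no definition, no named fact, no `sorry`.

For `L` with `IsCyclotomicExtension {24} ℚ L`: `Gal(L/ℚ) ≅ (ℤ/24)ˣ ≅ (ℤ/2)³` is commutative of exponent `2`
(`gal_mul_self_twentyFour`, `gal_comm_twentyFour`, Mathlib's `IsCyclotomicExtension.autEquivPow`), `[L:ℚ] = 8`, and by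
the census every SIMPLE realisation of a CM type of `L` has a NONDEGENERATE type
(`CyclotomicRank.isNondegenerate_iff_isSimple_twentyFour`).  Hence, for `E` an elliptic curve with CM by an imaginary
quadratic field `k` with `j : k → L` (`k ∈ {ℚ(i), ℚ(√-2), ℚ(√-3), ℚ(√-6)}`) and `Y` a SIMPLE abelian fourfold realising
a CM type of `L`:

* **`hodgeClassesProductSpan_curve_zeta24`** — every Hodge class on `E × Y` is a combination of exterior products;
* **`hodgeConjectureFor_curve_prod_zeta24`** — the Hodge conjecture for the fivefold `E × Y`, unconditionally;
* **`exists_not_hodgeClassesProductSpan_powSucc_zeta24`** — some `E^{a+1} × Y^{a+1}` carries a rational Hodge class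
  that is NOT such a combination (`Hg(E × Y) ⊊ Hg(E) × Hg(Y)`: the Weil classes of `k`); explicitly
  (**`not_hodgeClassesProductSpan_sq_curve_zeta24`**, `CorCM/CurveTimesMultiquadraticCMSquare`) already `E² × Y` fails.

## References
* [MoonenZarhin1999LowDim] B. Moonen, Yu. Zarhin, Math. Ann. 315 (1999) 711–733, §3 (3.1), Thm. (0.2).
* [Washington1997] L. C. Washington, *Introduction to Cyclotomic Fields*, Thm. 2.5 (`Gal(ℚ(ζ_n)/ℚ) ≅ (ℤ/n)ˣ`).
* [Kubota1965] T. Kubota, Trans. AMS 118 (1965), §4 Lemma 2.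
-/

noncomputable section

open CategoryTheory CategoryTheory.Limits NumberField Polynomial

namespace Summit.HodgeConjecture.CorCM.Multiquadratic

open Literature.AlgebraicGeometry.Motives (AbelianVariety CMType)
open Literature.AlgebraicGeometry.Motives.AbelianVariety
open Literature.AlgebraicGeometry.HodgeTheory
open Literature.AlgebraicGeometry.ComplexMultiplication (IsCMTypeRealisation)
open Literature.AlgebraicGeometry.Pohlmann1968

section Zeta24

variable (L : Type) [Field L] [NumberField L] [IsCyclotomicExtension {24} ℚ L]

/-- `Φ₂₄` is irreducible over `ℚ`. [cite: Washington1997, Thm. 2.5] -/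
private theorem irreducible_cyclotomic_24 : Irreducible (cyclotomic 24 ℚ) :=
  cyclotomic.irreducible_rat (by norm_num)

/-- Every unit modulo `24` squares to `1`: `(ℤ/24)ˣ ≅ (ℤ/2)³`. [cite: Washington1997, Thm. 2.5] -/
private theorem units_mul_self_twentyFour : ∀ u : (ZMod 24)ˣ, u * u = 1 := by decide

/-- **`Gal(ℚ(ζ₂₄)/ℚ)` has exponent `2`**: `g² = 1` for every automorphism (`Gal ≅ (ℤ/24)ˣ ≅ (ℤ/2)³`).
[cite: Washington1997, Thm. 2.5] -/
theorem gal_mul_self_twentyFour (g : L ≃ₐ[ℚ] L) : g * g = 1 := by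
  apply (IsCyclotomicExtension.autEquivPow L (irreducible_cyclotomic_24)).injective
  rw [map_mul, map_one]
  exact units_mul_self_twentyFour _

/-- `Gal(ℚ(ζ₂₄)/ℚ)` is commutative. [cite: Washington1997, Thm. 2.5] -/
theorem gal_comm_twentyFour (g h : L ≃ₐ[ℚ] L) : g * h = h * g := by
  apply (IsCyclotomicExtension.autEquivPow L (irreducible_cyclotomic_24)).injective
  rw [map_mul, map_mul, mul_comm]

/-- `[ℚ(ζ₂₄) : ℚ] = φ(24) = 8`. [cite: Washington1997, Thm. 2.5] -/
theorem finrank_twentyFour : Module.finrank ℚ L = 8 := by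
  rw [IsCyclotomicExtension.finrank L (irreducible_cyclotomic_24)]
  decide

variable {L}
variable {k : Type} [Field k] [NumberField k] [IsCMField k] {Φk : CMType k} {Φ : CMType L}
  {E Y : AbelianVariety ℂ} {ιE : 𝓞 k →+* End E} {ιY : 𝓞 L →+* End Y}
  {θE : k →+* Module.End ℂ (complexBetti E.X 1)} {θY : L →+* Module.End ℂ (complexBetti Y.X 1)}

/-- **Every Hodge class on `E × Y` is a combination of exterior products**, for `E` an elliptic curve with CM by an
imaginary quadratic `k ⊆ ℚ(ζ₂₄)` and `Y` a SIMPLE abelian fourfold with CM by `ℚ(ζ₂₄)`.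
[cite: MoonenZarhin1999LowDim, §3 (3.1) and Thm. (0.2)] [cite: Kubota1965, §4 Lemma 2] -/
theorem hodgeClassesProductSpan_curve_zeta24 (hk : Module.finrank ℚ k = 2) (j : k →+* L)
    (hE : IsCMTypeRealisation Φk E ιE θE) (hY : IsCMTypeRealisation Φ Y ιY θY) (hsimple : Y.IsSimple) :
    HodgeClassesProductSpan E Y := by
  haveI := IsCyclotomicExtension.isGalois {24} ℚ L
  haveI : IsCMField L := CyclotomicRank.isCMField_of_two_lt (N := 24) (L := L) (by norm_num)
  exact hodgeClassesProductSpan_curve_multiquadratic hk j (gal_comm_twentyFour L) (gal_mul_self_twentyFour L)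
    (by rw [finrank_twentyFour L]; norm_num) ((CyclotomicRank.isNondegenerate_iff_isSimple_twentyFour hY).2 hsimple)
    hE hY

/-- **The Hodge conjecture for `E × Y`** (`E` a CM elliptic curve with CM field inside `ℚ(ζ₂₄)`, `Y` a simple abelian
fourfold with CM by `ℚ(ζ₂₄)`), unconditionally. [cite: MoonenZarhin1999LowDim, §3 (3.1) and Thm. (0.2)] -/
theorem hodgeConjectureFor_curve_prod_zeta24 (hk : Module.finrank ℚ k = 2) (j : k →+* L)
    (hE : IsCMTypeRealisation Φk E ιE θE) (hY : IsCMTypeRealisation Φ Y ιY θY) (hsimple : Y.IsSimple) :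
    HodgeConjectureFor (E.prod Y).dim (E.prod Y).X := by
  haveI := IsCyclotomicExtension.isGalois {24} ℚ L
  haveI : IsCMField L := CyclotomicRank.isCMField_of_two_lt (N := 24) (L := L) (by norm_num)
  exact hodgeConjectureFor_curve_prod_multiquadratic hk j (gal_comm_twentyFour L) (gal_mul_self_twentyFour L)
    (by rw [finrank_twentyFour L]; norm_num) ((CyclotomicRank.isNondegenerate_iff_isSimple_twentyFour hY).2 hsimple)
    hE hY

/-- **Some `E^{a+1} × Y^{a+1}` carries a Hodge class outside the span of exterior products** (`Hg(E × Y) ⊊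
Hg(E) × Hg(Y)`), for the same `E`, `Y`. [cite: MoonenZarhin1999LowDim, §3 (3.1)] -/
theorem exists_not_hodgeClassesProductSpan_powSucc_zeta24 (hk : Module.finrank ℚ k = 2) (j : k →+* L)
    (hE : IsCMTypeRealisation Φk E ιE θE) (hY : IsCMTypeRealisation Φ Y ιY θY) (hsimple : Y.IsSimple) :
    ∃ a : ℕ, ¬ HodgeClassesProductSpan (E.powSucc a) (Y.powSucc a) := by
  haveI : IsCMField L := CyclotomicRank.isCMField_of_two_lt (N := 24) (L := L) (by norm_num)
  exact exists_not_hodgeClassesProductSpan_powSucc_curve hk j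
    ((CyclotomicRank.isNondegenerate_iff_isSimple_twentyFour hY).2 hsimple) hE hY

omit [IsCMField k] in
/-- **Already `E² × Y` fails**: for `E` with CM by an imaginary quadratic `k ⊆ ℚ(ζ₂₄)` and `Y` a simple abelian
fourfold with CM by `ℚ(ζ₂₄)`, `E² × Y` carries a rational `(3,3)`-class (a Weil class of `k`) outside the span of
exterior products of Hodge classes of `E²` and `Y`. [cite: MoonenZarhin1999LowDim, §3 (3.1) and Thm. (0.2)] -/
theorem not_hodgeClassesProductSpan_sq_curve_zeta24 (hk : Module.finrank ℚ k = 2) (j : k →+* L)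
    (hE : IsCMTypeRealisation Φk E ιE θE) (hY : IsCMTypeRealisation Φ Y ιY θY) (hsimple : Y.IsSimple) :
    ¬ HodgeClassesProductSpan (E.powSucc 1) Y := by
  haveI := IsCyclotomicExtension.isGalois {24} ℚ L
  haveI : IsCMField L := CyclotomicRank.isCMField_of_two_lt (N := 24) (L := L) (by norm_num)
  exact not_hodgeClassesProductSpan_sq_curve_multiquadratic_octic hk j (gal_comm_twentyFour L)
    (gal_mul_self_twentyFour L) (finrank_twentyFour L)
    ((CyclotomicRank.isNondegenerate_iff_isSimple_twentyFour hY).2 hsimple) hE hY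

end Zeta24

end Summit.HodgeConjecture.CorCM.Multiquadratic

end
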